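import Mathlib
import HarnessLib
import HarnessLib.Audit
import Summits.BirchSwinnertonDyer.Statement
import Summits.BirchSwinnertonDyer.BirchSwinnertonDyer.Theorems.EisensteinPrimesInputs
import Summits.BirchSwinnertonDyer.BirchSwinnertonDyer.Theorems.Rank1ResidualX1Defs
import Summits.BirchSwinnertonDyer.Rank1Residual.X1.RankZeroDoubleTwistTransport
import Summits.BirchSwinnertonDyer.Rank1Residual.WAll.Target
import Summits.BirchSwinnertonDyer.Rank1Residual.WAll.AltClosersGlue
import Summits.BirchSwinnertonDyer.Rank1Residual.WAll.AltClosersResidualCellsX1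
import Summits.BirchSwinnertonDyer.BirchSwinnertonDyer.Theorems.SlopeDichotomyA2DegenerateLocusA2AnticyclotomicRoad
import HarnessLib.Audit.Status.Attr

/-!
Route: RealTwistEisenstein

CLOSED (superseded) 2026-08-27T07:16:10Z by planner-bsd-wall-eis-g2-0 — reason: superseded:route-BirchSwinnertonDyer-EisensteinPrimes — superseded by route-BirchSwinnertonDyer-EisensteinPrimes — note: director-bsd g8 ruling (β) 07:05:46Z: census: LW23 criterion 0 movable cells (c6a960fd); balanced ∩ residue 0/149 (f485c167); re-target moves 0 cells and is dominated by K5 (same PRE 19032); banked: LW Cor 1.8 p502301, criterion table 27a3e298, X1 slice leaves p507296. The file is kept as the record of this route; refuted decls are indexed as negative knowledge (`ledger negatives`).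

# Route RealTwistEisenstein — real-quadratic Eisenstein units criterion decides the double-twist
certificate on the balanced Mazur class (W-ALL row 4, X1)

It suffices to show X = X_B ∧ R, closing the W-ALL row-4 leaf `WAllCornerX1` (= `¬CM → ClassX1 W p →
r_an ≤ 1 → BSDp W p`) through the tree's
Schneider-free double-twist transport
(`bsdpOnClassX1_of_goodLatticeBDPValue_of_doubleTwistCertificateSupply`, K5 crux 19032 + PUB + the
rank-0 rider `DoubleTwistCertificateSupply`). X_B (ATTACKED): on the BALANCED MAZUR CLASS of rank-0
X1 pairs (squarefree N; an isogenous curve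
with a rational point of order divisible by p and ord_p ∏ c_ℓ = 1 — e.g. 11a@5, 19a@3, 14a@3, 26b@7,
35a@3; never Greenberg–Vatsal, so type A)
the rider is DECIDED BY A CRITERION, in two pieces: K1 `RealTwistEisensteinCriterion` (if the real
field F = ℚ(√(d_K d_K')) of an admissible
double-twist datum has p ∤ h(F) and, at each ℓ ∣ N with ℓ ≡ 1 (mod p), a unit that is not a p-th
power modulo a prime over ℓ, then
L(E^(d_K d_K'),1) ≠ 0 and an isogenous model of the double twist has p-adic-unit #Ш_an) and K2
`RealTwistCriterionSupply` (every balanced pair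
has an admissible datum whose F passes the criterion). R (RESIDUAL, imported): K3
`UnbalancedRankZeroBSDp` = Miller's BSD(E,p) on the complement of the balanced class
(BSD(E,p) currency — a literal slice of row 4,
`Rank1Residual.WAll.unbalancedRankZeroBSDp_of_wallCornerX1`; rev 3, superseding the
certificate-currency `UnbalancedRankZeroResidual`). Supports (shared with route EisensteinPrimes):
`GoodLatticeBDPValue` (K5 item 19032, Keller–Yin IMC2), `PublishedInputs`
(K5 item 19037), `WuthrichShaDvdAnalyticSha` (Wuthrich 2014 Prop 21).
Lean: `RealTwistEisensteinCriterion → RealTwistCriterionSupply → UnbalancedRankZeroBSDp →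
GoodLatticeBDPValue → PublishedInputs → WuthrichShaDvdAnalyticSha →
Summit.BirchSwinnertonDyer.WAllCornerX1`

## Assembly
Pure logic, proved sorry-free in SketchGlue.lean (`closes`, rc 0): for a rank-0 leaf pair decide
`Balanced W p`; on the balanced branch K2 supplies (K, Wd, K', F) and K1 turns the criterion into
the remaining clauses of `DoubleTwistPartnerAt W p`; on the other branch K3 gives it; this is
`DoubleTwistCertificateSupply`, and the tree's
`bsdpOnClassX1_of_goodLatticeBDPValue_of_doubleTwistCertificateSupply` (with GoodLatticeBDPValue,
the eleven conjuncts of PublishedInputs it consumes, WuthrichShaDvdAnalyticSha) yields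
`BSDpOnClassX1`, whence `wallCornerX1_of_bsdpOnClassX1`.

CLOSES_TARGET: closes rung W-ALL/4 of BirchSwinnertonDyer: Summit.BirchSwinnertonDyer.WAllCornerX1 (D-0061; not the summit Statement) — the deciding theorem of this route concludes that registered leaf instead of the Statement decl `BirchSwinnertonDyer` (class rung: servable and labelled, never counted as concluding the summit Statement).

Rationale: WHY THIS LINE. Mechanism: over a real quadratic F in which every ℓ ∣ Np splits, L(E^(D),1)·√D/Ω⁺ is
a sum m_D of periods of f_E over the h⁺(D) closed
Shintani/Heegner cycles (Popa2006-type formula); pairing with the plus Eisenstein functional γ ↦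
log_𝔫 d(γ) of the Eisenstein ideal
(Mazur1977, Merel1996, WakeWangErickson2021 at squarefree level) kills the first-order term
identically (LecouturierWang2023 Thm 1.3) and
leaves the SECOND-order digit m_D ≡ u·h(F)·log_𝔫(ε_F) (mod p), a unit u exactly on the balanced
class — so «p ∤ h(F) ∧ ε_F not a p-th power
mod 𝔫» gives L(E^(D),1) ≠ 0 AND ord_p #Ш_an(E^(D)) = 0 at once, while the same criterion is ⟺
Sel_p(E^(D)) = 0 on the algebraic side
(LecouturierWang2023 Thm 1.7 (iii), de Shalit's comparison). Imported area: Eisenstein-ideal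
arithmetic of modular curves / higher
Eisenstein elements and real-quadratic class-number–unit arithmetic, transplanted into the BSD
residual through the tree's quadratic-twist
transport (Wuthrich2014 Prop 21 ⇒ Ш[p] = 0 ⇒ BSD_p of the twist exact ⇒ KellerYin2024 display twice
⇒ BSD_p(E)). What no prior route does:
K5's rider 19035/`DoubleTwistCertificateSupply` is decided per pair by SEARCH (k5-c5 jobs
j253630/j254963); the mu lanes go through
exact μ (barrier EisensteinMuConjecture); no BSD route or line uses real-quadratic periods, Shintani
cycles or LecouturierWang2023, and
LIT-DOSSIER §51 does not list it. The route is height-free and μ-free.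

RANKED CRUXES. #2 RealTwistEisensteinCriterion (crux) — for every rank-0 X1 leaf pair (W,p) in the
balanced Mazur class and every admissible double-twist datum (K, Wd ≅ W^(d_K) of analytic rank 1,
K') whose real field F with discr F = d_K·d_K' has p ∤ h(F) and, for each prime ℓ ∣ N_W with ℓ ≡ 1
(mod p), a unit of 𝓞_F that is not a p-th power modulo some prime of F over ℓ: L(Wd^(d_K'),1) ≠ 0
and some curve isogenous to a minimal model of Wd^(d_K') has #Ш_an = q ∈ ℚ with ord_p q = 0
(LecouturierWang2023 Thm 1.7 / Cor 1.8 extended from prime N, p ≥ 5, to squarefree N, p ≥ 3,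
elliptic optimal factor). [difficulty: L] (why it might fail: LW23 needs N prime, p ≥ 5, p ‖ N−1 and
Hyp (H) #S₂^Eis = g_p to isolate the elliptic factor; at squarefree N multiplicity one of the plus
Eisenstein functional can fail (Yoo, WWE21) and p = 3 or p | c_ℓ with ℓ ≢ 1 (p) (26b: ℓ = 2) may
force extra digits.) [LecouturierWang2023, Mazur1977, Mazur1979, Merel1996, WakeWangErickson2021,
Vatsal1999]
#3 RealTwistCriterionSupply (crux) — every rank-0 X1 leaf pair (W,p) in the balanced Mazur class
admits an imaginary quadratic K (odd d_K < −4, all ℓ ∣ N and p split) with a globally minimal model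
Wd of W^(d_K) of analytic rank 1, an admissible K' for Wd, and a real quadratic F with discr F =
d_K·d_K', p ∤ h(F), and at each ℓ ∣ N with ℓ ≡ 1 (mod p) a unit of 𝓞_F that is not a p-th power
modulo a prime over ℓ (the existence half of the density question LecouturierWang2023 p. 5 leave
open). [difficulty: L] (why it might fail: needs p ∤ h(F) for real quadratic F in a thin family (d_K
fixed factor, every ℓ ∣ pN split) TOGETHER with a non-p-th-power unit condition that no congruence
on D controls; Byeon/BRR-type indivisibility theorems fix only finitely many split conditions and
say nothing about ε_F mod 𝔩.) [LecouturierWang2023, BeckwithRaumRichter2024,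
BumpFriedbergHoffstein1990, HoffsteinLuo1997]
#4 UnbalancedRankZeroBSDp (crux) — RESIDUAL (imported complement, not attacked here; BSD(E,p)
currency — a LITERAL SLICE of row 4, `Rank1Residual.WAll.unbalancedRankZeroBSDp_of_wallCornerX1`,
p500626): Miller's BSD(E,p) at every rank-0 X1 leaf pair (W,p) with NO balanced structure (N not
squarefree, or no isogenous curve with p ∣ #tors and ord_p ∏c_ℓ = 1 — ψ ≠ 1 or Tamagawa/torsion
imbalance). Supersedes the certificate-currency residual `UnbalancedRankZeroResidual` (ty-2 lane
note 2026-08-27 05:22:37Z): that one was STRONGER than the slice of the row it stood for; this one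
is implied by it mod h308 + PUB (`unbalancedRankZeroBSDp_of_h308_of_unbalancedCertificate`) and by
K5's crux MazurMCOnX1RankZero (item 19035) + PUB (`X1.RankZero.statement_of_bsdpOnClassX1` road),
which remains the owner of this cell. [difficulty: open-problem] [difficulty: open-problem] (why it
might fail: it is BSD_p itself on the unbalanced rank-0 Eisenstein cell (146 classes @3, 3 @5, minus
the balanced share): no Euler-system / main-conjecture input is in print there (anomalous Heegner
log wall; definite-side μ_an > 0), and one class with p-part of #Ш·∏c_ℓ ≠ p-part of #Ш_an refutes
it.) [KellerYin2024, Wuthrich2014, Mazur1978]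
#9 GoodLatticeBDPValue (support) — Keller–Yin Thm 3.0.8 (IMC2 at the trivial character for the good
lattice) — verbatim the signature of route EisensteinPrimes item 19032 (shared; that route's rank-2
crux, staffed there). [difficulty: open-problem] [KellerYin2024]
#9 PublishedInputs (support) — the published named facts the transport consumes, one conjunction —
verbatim the signature of route EisensteinPrimes item 19037 (shared). [difficulty: provable-now]
[CastellaGrossiLeeSkinner2022, GreenbergVatsal2000, HoffsteinLuo1997, Wuthrich2014]
#9 WuthrichShaDvdAnalyticSha (support) — Wuthrich 2014 Prop. 21: at a reducible prime p of a rank-0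
curve, #Ш(E)[p^∞] divides the p-part of #Ш_an (named Literature fact, used as a hypothesis).
[difficulty: provable-now] [Wuthrich2014]

TWO-LAYER PLAN. K1 ⇐ (AnalyticDigit: criterion ⇒ ord_p(L(W^D,1)√D/Ω⁺) = ord_p Tam(W^D) − 2·ord_p
#tors) → (Certificate: exact valuation ⇒ p-unit #Ш_an member ∧ L ≠ 0) → K1; optionally a third child
SelmerDigit (criterion ⇒ Sel_p(W^D) = 0, LW23 Thm 1.7 (iii)) as the algebraic cross-check. K2 ⇐
(RankOnePartner: admissible K with r_an(W^(d_K)) = 1, from BumpFriedbergHoffstein1990 +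
Gross–Zagier–Kolyvagin) → (CritField: for fixed (W, p, K, Wd) infinitely many admissible K' whose F
passes the criterion) → K2. Nothing filed now.

KILL CRITERIA. A balanced pair (W,p) and admissible datum with the criterion TRUE but p ∣ #Ш_an at
every curve isogenous to the double twist (or L(W^D,1) = 0) refutes K1 ⇒ close
`refuted:RealTwistEisensteinCriterion` unless the witness is p = 3 / ℓ ≢ 1 (p) only (then restate K1
at p ≥ 5, ℓ ≡ 1). A balanced pair with NO admissible datum passing the criterion up to a certified
bound does not refute K2 (∃ over an infinite family) but a proof that p ∣ h(F)·[ε_F p-th power] for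
ALL admissible F of some pair kills K2 ⇒ pivot to higher-order digits. K3 refuted ⇒ the rider is
false off the balanced class: the route survives as the balanced-class theorem but no longer closes
row 4 (re-target to the leaf restricted to the balanced class). KY Thm 4.2.1 verified as a theorem
(K5 crux 19032 + 19035 closed) moots the route.

NOT DECOMPOSED YET. The multiplicity-one / Gorenstein input for the plus Eisenstein functional at
squarefree level (WakeWangErickson2021, Yoo), the p = 3 case, the exact period normalisation (Manin
constant, c_∞) inside m_D, and the isogenous-model bookkeeping (which member carries the p-unit
#Ш_an) — all layer-2 children of K1; the analytic-rank-1 partner existence is a provable-now child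
of K2.

CHEAPEST FALSIFIER. Run the criterion against the k5-c5 double-twist tables (j253630/j254963) on
balanced rows: DONE locally (calc/rqcrit.py, pure python — narrow class number by reduced-cycle
counting, fundamental unit by continued fraction, p-th-power test mod 𝔩): 16/16 agreement between
«criterion holds» and «p-unit #Ш_an member found» on 11a@5 (D = 969, 1409, 2329, 2869-type rows),
19a@3, 14a@3, 35a@3, and 3/3 sufficiency on 26b@7; first disagreement of the SUFFICIENCY direction
on any balanced row kills K1. Next cheapest: LW23 Cor 1.8 itself at (11,5) is a theorem — a single
real D with 11 split, criterion true and 5 ∣ #Ш(E_D) would contradict print.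

NUMBERS. Balanced examples and their invariants: 11a1@5 (#tors 5, c_11 = 5), 19a1@3 (#tors 3, c_19 =
3), 14a1@3 (#tors 6, c_2·c_7 = 2·3... ord_3 = 1), 26b1@7 (#tors 7, c_2 = 7? ord_7 ∏c = 1), 35a1@3
(#tors 3, ord_3 ∏c = 1). LW23 Hyp (H) list at p = 5, N < 10000:
(11,1),(31,2),(211,2),(1871,2),(4621,2),(9931,2). N1″ residue of k5-c5: 149 classes (146 @3, 3 @5),
naive criterion off the balanced class: 31 ok / 25 bad / 42 none / 29 multi of 127 rows. Cell census
(pub/bsd-eis README eade7bc0a2387e7b): A1 type-A r=1 7 892 cells, A2 type-B r=1 1 307 cells, A3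
type-A r=0 149 classes (28 open + 121 transports) — all N < 5·10⁵; the balanced share of A3 is a
count owed (needs torsion/Tamagawa per class; no kit on this seat).

DEFINITION REQUESTS. None for opening: `NumberField.classNumber`, `Ideal.primesOver`, `(𝓞 F)ˣ`,
`WeierstrassCurve.torsionOrder`, `tamagawaProduct`, `IsIsogenous`, `RankZero.Leaf`,
`DoubleTwistPartnerAt` all exist. Cite fact wanted (filed after open): LecouturierWang2023 Thm 1.7 +
Cor 1.8 as a named Literature fact (prime level, p ≥ 5) — the BC5 first rung of K1.

Novelty: Searches (2026-08-27): lit search "Eisenstein ideal real quadratic twist L-value congruence" (corpus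
fts: 0 relevant; OpenAlex/S2: LecouturierWang2023 = arXiv:2305.00643 found and READ pp. 1–27); lit
search --hybrid "higher Eisenstein element special value real quadratic" (LW23, Lecouturier 2020/21
higher Eisenstein elements, Merel1996); lit galaxy search "higher Eisenstein|Eisenstein quotient
twist|Shintani cycle" --star all (pdf: LW23-adjacent only; panama 0; crabby 0); lit search "class
number real quadratic not divisible split primes" (Byeon, Ono, BRR24 imaginary = tree
IndivisibleClassNumberSplitPrimes); tree: lean search 'DoubleTwist' (K5/k5-c5 files only), grep of
every BSD Theses/*.lean for Shintani/Eisenstein-criterion levers (none); pub/bsd-eis/LIT-DOSSIER.md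
§51 (nearest listed: Vatsal1999, Ono–Skinner, BRR, Kriz–Li — LW23 absent).
Nearest prior art found: LecouturierWang2023 (arXiv:2305.00643) Thm 1.7 / Cor 1.8 — the criterion at
PRIME level N, p ≥ 5, p ‖ N−1, for the Eisenstein quotient, with the Selmer equivalence, and the
density question left open (p. 5); Vatsal1999 / Mazur1979 (odd = imaginary twists only); K5's rider
`DoubleTwistCertificateSupply` (search, no criterion).
Delta: moves the LW23 second-order Eisenstein criterion to the balanced Mazur class at squarefree
level and p = 3 for the elliptic factor, adds the SUPPLY theorem the authors leave open (existence,
not density), and wires both through the tree's double-twist transport so that a units/class-n  [refs: 2305.00643, LecouturierWang2023, Merel1996, Vatsal1999, Mazur1979]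

Barriers (technique_class: eisenstein-congruence, real-quadratic-periods, twist): - technique_class: eisenstein-congruence, real-quadratic-periods, twist
- Literature.Barriers.BirchSwinnertonDyer.AnomalousHeegnerLogWall: evaded — no Heegner point, BDP
logarithm or anticyclotomic class at the anomalous prime enters K1/K2 (periods over REAL quadratic
cycles and p-adic logs of UNITS mod 𝔫); the only BDP-type input is the shared good-lattice value
19032, already K5's.
- Literature.Barriers.BirchSwinnertonDyer.EisensteinMuBarrier: evaded — the line never computes or
bounds μ or λ of any Selmer group; it certifies p ∤ #Ш_an(W^D) and Ш(W^D)[p] = 0 directly (Wuthrich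
Prop 21), so «exact μ at Eisenstein p» is not on the path.
- Literature.Barriers.BirchSwinnertonDyer.PAdicHeightBarrier: evaded — rank-0 pair and rank-0 double
twist: no p-adic height or regulator anywhere (the rank-1 middle twist is consumed only through the
KY display inside the shared support).
- Literature.Barriers.BirchSwinnertonDyer.AnticyclotomicHeightDegeneracy: evaded for the same reason
(no anticyclotomic heights).
- Literature.Barriers.BirchSwinnertonDyer.ReducibleAnticyclotomicAtBadP: not applicable — p is a
prime of good reduction on X1.
- Negatives index: no refuted BSD statement concerns real-quadratic twists, Eisenstein congruences
of periods, or the double-twist rider (checked `ledger negatives --problem BirchSwinnertonDyer` at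
filing); the naive class-wide form of K1 (no balance hypothesis) is recorded in NOTES as
self-refuted by the N1″ tables and is NOT filed.

History (route lifecycle, newest last):
- 2026-08-27T05:07:01Z · AUTO-CRUX (open): GoodLatticeBDPValue — hypotheses of the deciding theorem that nothing in the route derives are cruxes (planner-bsd-wall-eis-g0-0)
- 2026-08-27T05:52:50Z · rev 3: restated UnbalancedRankZeroResidual (stmt-BirchSwinnertonDyer-20221), Assembly (stmt-BirchSwinnertonDyer-20222) — planner bsd-wall-eis g0 (opening planner): WEAKEN THE RESIDUAL to BSD(E,p) currency per ty-2 lane note 05:22:37Z — restate crux UnbalancedRankZeroResidual (cert (planner-bsd-wall-eis-g0-0)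
- 2026-08-27T07:16:11Z · CLOSED superseded — superseded:route-BirchSwinnertonDyer-EisensteinPrimes (planner-bsd-wall-eis-g2-0)

sub-problem: BirchSwinnertonDyer · status: closed(superseded) · opened planner-bsd-wall-eis-g0-0 2026-08-27T05:06:07Z · rev 4 · ledger route-BirchSwinnertonDyer-RealTwistEisenstein
GENERATED by the gate from the ledger (D-0016/17). Provers cite these decls: `theorem foo : Summit.BirchSwinnertonDyer.BirchSwinnertonDyer.Theses.RealTwistEisenstein.<Decl> := …` in Summits/BirchSwinnertonDyer/BirchSwinnertonDyer/Theorems/<Name>.lean.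
-/

namespace Summit.BirchSwinnertonDyer.BirchSwinnertonDyer.Theses.RealTwistEisenstein

open scoped BigOperators Topology Manifold Classical MeasureTheory ProbabilityTheory Matrix InnerProductSpace ComplexConjugate ContinuousMap
open Filter Set Function TopologicalSpace MeasureTheory

attribute [summit_statement] _root_.BirchSwinnertonDyer
attribute [summit_statement] _root_.Summit.BirchSwinnertonDyer.WAllCornerX1

open Literature

/-- item stmt-BirchSwinnertonDyer-20219 · crux · rank 2 · closed · moot by None · by planner
why it might fail: LW23 needs N prime, p ≥ 5, p ‖ N−1 and Hyp (H) #S₂^Eis = g_p to isolate the elliptic factor; at squarefree N multiplicity one of the plus Eisenstein functional can fail (Yoo, WWE21) and p = 3 or p | c_ℓ with ℓ ≢ 1 (p) (26b: ℓ = 2) may force extra digits.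
sources: LecouturierWang2023, Mazur1977, Mazur1979, Merel1996, WakeWangErickson2021, Vatsal1999
[crux] for every rank-0 X1 leaf pair (W,p) in the balanced Mazur class and every admissible
double-twist datum (K, Wd ≅ W^(d_K) of analytic rank 1, K') whose real field F with discr F =
d_K·d_K' has p ∤ h(F) and, for each prime ℓ ∣ N_W with ℓ ≡ 1 (mod p), a unit of 𝓞_F that is not a
p-th power modulo some prime of F over ℓ: L(Wd^(d_K'),1) ≠ 0 and some curve isogenous to a minimal
model of Wd^(d_K') has #Ш_an = q ∈ ℚ with ord_p q = 0 (LecouturierWang2023 Thm 1.7 / Cor 1.8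
extended from prime N, p ≥ 5, to squarefree N, p ≥ 3, elliptic optimal factor). [difficulty: L] -/
@[route_item "route-BirchSwinnertonDyer-RealTwistEisenstein", crux]
def RealTwistEisensteinCriterion : Prop :=
  ∀ (W : WeierstrassCurve ℚ) [W.IsElliptic] [W.IsGloballyMinimal] (p : ℕ) [Fact p.Prime], Summit.BirchSwinnertonDyer.Rank1Residual.X1.RankZero.Leaf W p → (Squarefree (W.conductorNorm ℤ) ∧ ∃ (W' : WeierstrassCurve ℚ) (_ : W'.IsElliptic) (_ : W'.IsGloballyMinimal), WeierstrassCurve.IsIsogenous W W' ∧ p ∣ W'.torsionOrder ∧ padicValNat p W'.tamagawaProduct = 1) → ∀ (K : Type) [Field K] [NumberField K], Literature.NumberTheory.EllipticCurves.IsImaginaryQuadratic K → Odd (NumberField.discr K) → NumberField.discr K < -4 → Literature.NumberTheory.EllipticCurves.SatisfiesHeegnerHypothesis (W.conductorNorm ℤ) K → Literature.NumberTheory.EllipticCurves.SatisfiesHeegnerHypothesis p K → ∀ (Wd : WeierstrassCurve ℚ) [Wd.IsElliptic] [Wd.IsGloballyMinimal], (∃ C : WeierstrassCurve.VariableChange ℚ,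 C • Wd = W.quadraticTwist (NumberField.discr K : ℚ)) → Wd.analyticRank = 1 → ∀ (K' : Type) [Field K'] [NumberField K'], Literature.NumberTheory.EllipticCurves.IsImaginaryQuadratic K' → Odd (NumberField.discr K') → NumberField.discr K' < -4 → Literature.NumberTheory.EllipticCurves.SatisfiesHeegnerHypothesis (Wd.conductorNorm ℤ) K' → Literature.NumberTheory.EllipticCurves.SatisfiesHeegnerHypothesis p K' → (∃ (F : Type) (_ : Field F) (_ : NumberField F), Module.finrank ℚ F = 2 ∧ NumberField.discr F = NumberField.discr K * NumberField.discr K' ∧ ¬ p ∣ NumberField.classNumber F ∧ ∀ ℓ : ℕ, ℓ.Prime → ℓ ∣ W.conductorNorm ℤ → ℓ ≡ 1 [MOD p] → ∃ P ∈ (Ideal.span {(ℓ : ℤ)}).primesOver (NumberField.RingOfIntegers F), ∃ u : (NumberField.RingOfIntegers F)ˣ, ∀ v : NumberField.RingOfIntegers F ⧸ P, Ideal.Quotient.mk P (u : NumberField.RingOfIntegers F) ≠ v ^ p) → (Wd.quadraticTwist (NumberField.discr K' : ℚ)).entireLFunction 1 ≠ 0 ∧ ∃ (Wdd : WeierstrassCurve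 ℚ) (_ : Wdd.IsElliptic) (_ : Wdd.IsGloballyMinimal), (∃ C' : WeierstrassCurve.VariableChange ℚ, C' • Wdd = Wd.quadraticTwist (NumberField.discr K' : ℚ)) ∧ ∃ (Wc : WeierstrassCurve ℚ) (_ : Wc.IsElliptic) (_ : Wc.IsGloballyMinimal), WeierstrassCurve.IsIsogenous Wdd Wc ∧ ∃ q : ℚ, Literature.NumberTheory.EllipticCurves.shaAn Wc = (q : ℂ) ∧ padicValRat p q = 0

/-- item stmt-BirchSwinnertonDyer-20220 · crux · rank 3 · closed · moot by None · by planner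
why it might fail: needs p ∤ h(F) for real quadratic F in a thin family (d_K fixed factor, every ℓ ∣ pN split) TOGETHER with a non-p-th-power unit condition that no congruence on D controls; Byeon/BRR-type indivisibility theorems fix only finitely many split conditions and say nothing about ε_F mod 𝔩.
sources: LecouturierWang2023, BeckwithRaumRichter2024, BumpFriedbergHoffstein1990, HoffsteinLuo1997
[crux] every rank-0 X1 leaf pair (W,p) in the balanced Mazur class admits an imaginary quadratic K
(odd d_K < −4, all ℓ ∣ N and p split) with a globally minimal model Wd of W^(d_K) of analytic rank
1, an admissible K' for Wd, and a real quadratic F with discr F = d_K·d_K', p ∤ h(F), and at each ℓ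
∣ N with ℓ ≡ 1 (mod p) a unit of 𝓞_F that is not a p-th power modulo a prime over ℓ (the existence
half of the density question LecouturierWang2023 p. 5 leave open). [difficulty: L] -/
@[route_item "route-BirchSwinnertonDyer-RealTwistEisenstein", crux]
def RealTwistCriterionSupply : Prop :=
  ∀ (W : WeierstrassCurve ℚ) [W.IsElliptic] [W.IsGloballyMinimal] (p : ℕ) [Fact p.Prime], Summit.BirchSwinnertonDyer.Rank1Residual.X1.RankZero.Leaf W p → (Squarefree (W.conductorNorm ℤ) ∧ ∃ (W' : WeierstrassCurve ℚ) (_ : W'.IsElliptic) (_ : W'.IsGloballyMinimal), WeierstrassCurve.IsIsogenous W W' ∧ p ∣ W'.torsionOrder ∧ padicValNat p W'.tamagawaProduct = 1) → ∃ (K : Type) (_ : Field K) (_ : NumberField K), Literature.NumberTheory.EllipticCurves.IsImaginaryQuadratic K ∧ Odd (NumberField.discr K) ∧ NumberField.discr K < -4 ∧ Literature.NumberTheory.EllipticCurves.SatisfiesHeegnerHypothesis (W.conductorNorm ℤ) K ∧ Literature.NumberTheory.EllipticCurves.SatisfiesHeegnerHypothesis p K ∧ ∃ (Wd : WeierstrassCurve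 ℚ) (_ : Wd.IsElliptic) (_ : Wd.IsGloballyMinimal), (∃ C : WeierstrassCurve.VariableChange ℚ, C • Wd = W.quadraticTwist (NumberField.discr K : ℚ)) ∧ Wd.analyticRank = 1 ∧ ∃ (K' : Type) (_ : Field K') (_ : NumberField K'), Literature.NumberTheory.EllipticCurves.IsImaginaryQuadratic K' ∧ Odd (NumberField.discr K') ∧ NumberField.discr K' < -4 ∧ Literature.NumberTheory.EllipticCurves.SatisfiesHeegnerHypothesis (Wd.conductorNorm ℤ) K' ∧ Literature.NumberTheory.EllipticCurves.SatisfiesHeegnerHypothesis p K' ∧ ∃ (F : Type) (_ : Field F) (_ : NumberField F), Module.finrank ℚ F = 2 ∧ NumberField.discr F = NumberField.discr K * NumberField.discr K' ∧ ¬ p ∣ NumberField.classNumber F ∧ ∀ ℓ : ℕ, ℓ.Prime → ℓ ∣ W.conductorNorm ℤ → ℓ ≡ 1 [MOD p] → ∃ P ∈ (Ideal.span {(ℓ : ℤ)}).primesOver (NumberField.RingOfIntegers F), ∃ u : (NumberField.RingOfIntegers F)ˣ, ∀ v : NumberField.RingOfIntegers F ⧸ P, Ideal.Quotient.mk P (u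 : NumberField.RingOfIntegers F) ≠ v ^ p

/-- item stmt-BirchSwinnertonDyer-20335 · crux · rank 4 · closed · moot by None · by planner
why it might fail: it is BSD_p itself on the unbalanced rank-0 Eisenstein cell (146 classes @3, 3 @5, minus the balanced share): no Euler-system / main-conjecture input is in print there (anomalous Heegner log wall; definite-side μ_an > 0), and one class with p-part of #Ш·∏c_ℓ ≠ p-part of #Ш_an refutes it.
sources: KellerYin2024, Wuthrich2014, Mazur1978
[crux] RESIDUAL (imported complement, not attacked here; BSD(E,p) currency — a LITERAL SLICE of row
4, `Rank1Residual.WAll.unbalancedRankZeroBSDp_of_wallCornerX1`, p500626): Miller's BSD(E,p) at every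
rank-0 X1 leaf pair (W,p) with NO balanced structure (N not squarefree, or no isogenous curve with p
∣ #tors and ord_p ∏c_ℓ = 1 — ψ ≠ 1 or Tamagawa/torsion imbalance). Supersedes the
certificate-currency residual `UnbalancedRankZeroResidual` (ty-2 lane note 2026-08-27 05:22:37Z):
that one was STRONGER than the slice of the row it stood for; this one is implied by it mod h308 +
PUB (`unbalancedRankZeroBSDp_of_h308_of_unbalancedCertificate`) and by K5's crux MazurMCOnX1RankZero
(item 19035) + PUB (`X1.RankZero.statement_of_bsdpOnClassX1` road), which remains the owner of this
cell. [difficulty: open-problem] -/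
@[route_item "route-BirchSwinnertonDyer-RealTwistEisenstein", crux]
def UnbalancedRankZeroBSDp : Prop :=
  ∀ (W : WeierstrassCurve ℚ) [W.IsElliptic] [W.IsGloballyMinimal] (p : ℕ) [Fact p.Prime], Summit.BirchSwinnertonDyer.Rank1Residual.X1.RankZero.Leaf W p → ¬ (Squarefree (W.conductorNorm ℤ) ∧ ∃ (W' : WeierstrassCurve ℚ) (_ : W'.IsElliptic) (_ : W'.IsGloballyMinimal), WeierstrassCurve.IsIsogenous W W' ∧ p ∣ W'.torsionOrder ∧ padicValNat p W'.tamagawaProduct = 1) → Literature.NumberTheory.EllipticCurves.BSDp W p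

/-- item stmt-BirchSwinnertonDyer-19032 · crux (kind.auto-crux: conjecture-grade) · rank 9 · open · by planner
why it might fail: auto-crux — conjecture-grade (docstring avows it ('conjecture')): the deciding theorem assumes it and nothing in the route derives it, so it is a bet, not glue
sources: KellerYin2024
[crux] Keller–Yin 2024 Theorem 3.0.8 in the form the tree names
`thm308_imc2_bdpValue_goodLattice_OPEN`: for E/ℚ with a rational p-isogeny at a good anomalous
(Eisenstein) prime p and an admissible imaginary quadratic K, the anticyclotomic main conjecture
IMC2 holds integrally for the GOOD lattice and the BDP p-adic L-function takes the predicted value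
at the trivial character (the input h308 of Keller–Yin Theorem A on class X1 type A, rank 1; ladder
row A1, 7 892 cells ‖ 8 604 pairs). PREPRINT (arXiv v2); everything else Theorem A needs is
published and typed. [difficulty: L] -/
@[route_item "route-BirchSwinnertonDyer-RealTwistEisenstein", crux]
def GoodLatticeBDPValue : Prop :=
  Literature.NumberTheory.EllipticCurves.KellerYin2024.thm308_imc2_bdpValue_goodLattice_OPEN

/-- item stmt-BirchSwinnertonDyer-19037 · support · rank 9 · SPLIT (gen 1) into CGLSAnticyclotomicControlTorsionFree, BSDQuotientIsogenyInvariance, GVCharIdealEqOfGVPar, GreenbergCharValueRankZero, ModularParametrizationSupply, NewformOfEllipticCurve, HoffsteinLuoNonvanishingTwist, GrossZagierRationalPointI73, RankEqAnalyticRankLeOne, GVLambdaMuMultiplicative, WuthrichMultiplicativeDivisibilityReducible, PublishedInputsTail + glue PublishedInputsOfParts · direct attempts still welcome (low priority) · by planner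
sources: CastellaGrossiLeeSkinner2022, GreenbergVatsal2000, HoffsteinLuo1997, Wuthrich2014
[support] The PUBLISHED named facts the class assemblies display, as one conjunction of the tree's
cited `Prop`s: CGLS 2022 Thm 5.1.1 (torsion-free anticyclotomic control), Cassels' isogeny
invariance of the BSD quotient, Greenberg–Vatsal 2000 Thm 1.3 and the multiplicative (λ, μ) theorem,
Greenberg 1999 Thm 4.1 (rank-0 Euler characteristic), modularity (parametrisation, newform),
Hoffstein–Luo / BFH non-vanishing twists, Gross–Zagier I.7.3, Gross–Zagier and Kolyvagin over K,
rank = analytic rank ≤ 1 with Ш finite, Schneider 1985 (order of the characteristic power series,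
odd p), Perrin-Riou's rank-one leading terms (odd p), Wuthrich 2014 Thm 16, Stein–Wuthrich 2013 Thm
6.1 (split / non-split) and canonical multiplicative heights, Greenberg–Stevens 1993. Each conjunct
is a Literature fact with a cite tag; provable-now means: discharge conjunct by conjunct as the
`_holds` theorems land, else carried as displayed PUB hypotheses. [difficulty: provable-now] -/
@[route_item "route-BirchSwinnertonDyer-RealTwistEisenstein", crux]
def PublishedInputs : Prop :=
  Literature.NumberTheory.EllipticCurves.CastellaGrossiLeeSkinner2022.thm511_anticyclotomicControl_of_torsionFree ∧ WeierstrassCurve.bsdRHS_eq_of_isIsogenous ∧ Literature.NumberTheory.EllipticCurves.GreenbergVatsal2000.thm13_charIdeal_eq_of_gvPar ∧ Literature.NumberTheory.EllipticCurves.greenberg_charValue_rankZero ∧ Literature.NumberTheory.EllipticCurves.ModularForms.nonempty_modularParametrizationData ∧ Literature.NumberTheory.EllipticCurves.ModularForms.exists_isNewformOf ∧ Literature.NumberTheory.EllipticCurves.HoffsteinLuo1997_exists_twist_L_one_ne_zero ∧ Literature.NumberTheory.EllipticCurves.GrossZagier1986_thm_I_7_3 ∧ (∀ (N : ℕ) [NeZero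 N] (W : WeierstrassCurve ℚ) (K : Type) [Field K] [NumberField K], Literature.NumberTheory.EllipticCurves.gross_zagier N W K) ∧ (∀ (N : ℕ) [NeZero N] (W : WeierstrassCurve ℚ) (K : Type) [Field K] [NumberField K], Literature.NumberTheory.EllipticCurves.kolyvagin N W K) ∧ Literature.NumberTheory.EllipticCurves.rank_eq_analyticRank_of_analyticRank_le_one ∧ Literature.NumberTheory.EllipticCurves.Schneider1985_order_charGenerator_odd ∧ Literature.NumberTheory.EllipticCurves.perrinRiou_rankOne_leadingTerms_odd ∧ Literature.NumberTheory.EllipticCurves.GreenbergVatsal2000.lambdaMu_multiplicative_of_gvPar ∧ Literature.NumberTheory.EllipticCurves.Wuthrich2014.thm16_charIdeal_dvd_multiplicative_of_reducible ∧ Literature.NumberTheory.EllipticCurves.SteinWuthrich2013.thm61_splitMultiplicative ∧ Literature.NumberTheory.EllipticCurves.SteinWuthrich2013.thm61_nonsplitMultiplicative ∧ Literature.NumberTheory.EllipticCurves.SteinWuthrich2013.exists_isSplitMultCanonical ∧ Literature.NumberTheory.EllipticCurves.SteinWuthrich2013.exists_isMultCanonical ∧ (∀ (W : WeierstrassCurve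 ℚ) [W.IsElliptic] [W.IsGloballyMinimal] (p : ℕ) [Fact p.Prime], Literature.NumberTheory.EllipticCurves.greenberg_stevens (W := W) (p := p))

-- parent: PublishedInputs · child (gen 1)
/--     item stmt-BirchSwinnertonDyer-19485 · support · rank 901 · open
    parent: PublishedInputs · by operator
    sources: CastellaGrossiLeeSkinner2022
[support] Castella–Grossi–Lee–Skinner 2022 (Invent. Math. 227) Thm. 5.1.1: anticyclotomic control
for the torsion-free (BDP) Selmer group at an Eisenstein prime — conjunct 1 — conjunct of
PublishedInputs (stmt-BirchSwinnertonDyer-19037), BY NAME; same content, filed as a split child so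
the head constant is item-stated (gate5 #15c one rule; readiness rule 2026-08-15: cite_only dep
declared by the route; director-bsd 05:15:22Z K5 staffable remedy); no crux statement / closes /
tribunal change -/
@[route_item "route-BirchSwinnertonDyer-RealTwistEisenstein"]
def CGLSAnticyclotomicControlTorsionFree : Prop :=
  Literature.NumberTheory.EllipticCurves.CastellaGrossiLeeSkinner2022.thm511_anticyclotomicControl_of_torsionFree

-- parent: PublishedInputs · child (gen 1)
/--     item stmt-BirchSwinnertonDyer-19307 · support · rank 902 · open
    parent: PublishedInputs · by operator
    sources: Cassels1965ArithmeticVIII, MilneADT2006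
[support] Cassels 1965 (Arithmetic on curves of genus 1, VIII; J. reine angew. Math. 217) / Milne
ADT Thm I.7.3 and Rem I.7.4: the BSD quotient (right-hand side of the BSD formula) is invariant
under isogeny over ℚ — conjunct of the support PrintedFacts (stmt-BirchSwinnertonDyer-19362), BY
NAME; same content, filed as a split child so the head constant is item-stated (gate5 #15c one rule;
readiness rule 2026-08-15: cite_only dep declared by the route; director-bsd 2026-08-26T04:22Z
«K3/E2 shape»); no crux statement / closes / tribunal change -/
@[route_item "route-BirchSwinnertonDyer-RealTwistEisenstein"]
def BSDQuotientIsogenyInvariance : Prop :=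
  WeierstrassCurve.bsdRHS_eq_of_isIsogenous

-- parent: PublishedInputs · child (gen 1)
/--     item stmt-BirchSwinnertonDyer-19486 · support · rank 903 · open
    parent: PublishedInputs · by operator
    sources: GreenbergVatsal2000
[support] Greenberg–Vatsal 2000 (Invent. Math. 142) Thm. 1.3: at a GV pair (E[p] reducible, GV
parity condition) the cyclotomic main conjecture holds — conjunct 3 — conjunct of PublishedInputs
(stmt-BirchSwinnertonDyer-19037), BY NAME; same content, filed as a split child so the head constant
is item-stated (gate5 #15c one rule; readiness rule 2026-08-15: cite_only dep declared by the route;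
director-bsd 05:15:22Z K5 staffable remedy); no crux statement / closes / tribunal change -/
@[route_item "route-BirchSwinnertonDyer-RealTwistEisenstein"]
def GVCharIdealEqOfGVPar : Prop :=
  Literature.NumberTheory.EllipticCurves.GreenbergVatsal2000.thm13_charIdeal_eq_of_gvPar

-- parent: PublishedInputs · child (gen 1)
/--     item stmt-BirchSwinnertonDyer-19460 · support · rank 904 · closed · proved by Summit.BirchSwinnertonDyer.BirchSwinnertonDyer.Theorems.InputsDeskTwoTurnkey.smallImageMuTransfer_greenbergCharValueRankZero (prover)
    parent: PublishedInputs · by planner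
    sources: GreenbergLNM1716
[support, cite-only] Greenberg LNM 1716 Thm 4.1 (p. 102; held copy
book:coatesnd-arithmetic-theory-elliptic-curves chunk p0091): the rank-0 Euler-characteristic
formula f_E(0) ~ #Sel · ∏c_v · #Ẽ(𝔽_p)² / #E(ℚ)_tors² at good ordinary p — conjunct of
PublishedInputsX9 (stmt-BirchSwinnertonDyer-19632, text FROZEN REF v8-3), BY NAME; same content,
filed as a split child so the head constant is item-stated (readiness rule 2026-08-15 / gate5 #15c:
a cite_only dep must be declared by the route); no crux statement / closes / tribunal change; never
staffed for proof (cite-only, to be HELD), closes only when the named fact becomes a theorem -/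
@[route_item "route-BirchSwinnertonDyer-RealTwistEisenstein"]
def GreenbergCharValueRankZero : Prop :=
  Literature.NumberTheory.EllipticCurves.greenberg_charValue_rankZero

-- `GreenbergCharValueRankZero` holds: proved by `Summit.BirchSwinnertonDyer.BirchSwinnertonDyer.Theorems.InputsDeskTwoTurnkey.smallImageMuTransfer_greenbergCharValueRankZero` (its module imports this route file, so no `_holds` link can be stated here).

-- parent: PublishedInputs · child (gen 1)
/--     item stmt-BirchSwinnertonDyer-19266 · support · rank 905 · open
    parent: PublishedInputs · by planner
    sources: BCDT2001, Wiles1995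
[support] modularity of E/ℚ as parametrisation data (Breuil–Conrad–Diamond–Taylor 2001 Thm A), BY
NAME — conjunct of OrdPublishedInputsAtTwo (19149; Literature.Uncategorized.OrdPublishedInputsAtTwo
l.26); same content, filed so the head constant is item-stated (#15c one rule; cite_only dep) -/
@[route_item "route-BirchSwinnertonDyer-RealTwistEisenstein"]
def ModularParametrizationSupply : Prop :=
  Literature.NumberTheory.EllipticCurves.ModularForms.nonempty_modularParametrizationData

-- parent: PublishedInputs · child (gen 1)
/--     item stmt-BirchSwinnertonDyer-19382 · support · rank 906 · open
    parent: PublishedInputs · by planner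
    sources: BCDT2001, Wiles1995
[support] Modularity Theorem, Version L (Diamond–Shurman 2005 Thm. 8.8.3; Wiles / Taylor–Wiles /
BCDT 2001 Thm. A): every E/ℚ has a weight-2 newform f of level N_E with L(f,s) = L(E,s) — conjunct
of PublishedInputsFive (stmt-BirchSwinnertonDyer-19066), BY NAME; same content, filed as a split
child so the head constant is item-stated (gate5 #15c one rule / readiness rule 2026-08-15: a
cite_only dep must be declared by the route); no crux statement / closes / tribunal / tribunal_fit
change -/
@[route_item "route-BirchSwinnertonDyer-RealTwistEisenstein"]
def NewformOfEllipticCurve : Prop :=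
  Literature.NumberTheory.EllipticCurves.ModularForms.exists_isNewformOf

-- parent: PublishedInputs · child (gen 1)
/--     item stmt-BirchSwinnertonDyer-19372 · support · rank 907 · open
    parent: PublishedInputs · by planner
    sources: HoffsteinLuo1997, BumpFriedbergHoffstein1990
[aside] Hoffstein–Luo 1997 Theorem (§1, pp. 435–436), as used in Matsuno 2009 proof of Prop. 6.1: a
quadratic twist with L(E^D,1) ≠ 0 under prescribed local conditions — conjunct of
PublishedInputsFive (stmt-BirchSwinnertonDyer-19066) kept inside the k = 7 rest child
ClassicalAndTwistInputsFive and item-stated here BY NAME as an ASIDE (banked context, never staffed,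
BC6-exempt) so the cite_only dep is declared (#15c); no crux statement / closes / tribunal change -/
@[route_item "route-BirchSwinnertonDyer-RealTwistEisenstein"]
def HoffsteinLuoNonvanishingTwist : Prop :=
  Literature.NumberTheory.EllipticCurves.HoffsteinLuo1997_exists_twist_L_one_ne_zero

-- parent: PublishedInputs · child (gen 1)
/--     item stmt-BirchSwinnertonDyer-19369 · support · rank 908 · open
    parent: PublishedInputs · by planner
    sources: GrossZagier1986
[aside] Gross–Zagier 1986 Thm. I.(7.3) (p. 231; proof V.§2 pp. 310–313): L′(E,1) ≠ 0 ⇒ a rational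
point of infinite order (via a Heegner point and the GZ formula) — a cite_only dep of this route
reached through the depth-1 support item PublishedInputsIMCReduction
(stmt-BirchSwinnertonDyer-19283, child of 19061; a third item layer is forbidden, so it is
item-stated here as a by-name ASIDE: banked context, never staffed, BC6-exempt; gate5 02:15:40Z
«aside also counts»); no crux statement / closes / tribunal change -/
@[route_item "route-BirchSwinnertonDyer-RealTwistEisenstein"]
def GrossZagierRationalPointI73 : Prop :=
  Literature.NumberTheory.EllipticCurves.GrossZagier1986_thm_I_7_3

-- parent: PublishedInputs · child (gen 1)
/--     item stmt-BirchSwinnertonDyer-19921 · support · rank 909 · open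
    parent: PublishedInputs · by operator
    sources: GrossZagier1986, Kolyvagin1990
[support] The one PUBLISHED input the halves-glue consumes: Gross–Zagier–Kolyvagin, rank = analytic
rank for analytic rank ≤ 1 with Ш finite (tree named fact
rank_eq_analyticRank_of_analyticRank_le_one; used by bsdp_of_missingPPartAt to turn Miller's last
clause into BSD(E,2)). Carried as a displayed PUB hypothesis; never counted as progress. The further
PRINT of the roads to the two halves (Greenberg Thm-4.1 analogues at a multiplicative prime
thm41Analogue_charValue_rankZero_numberField_anyPrime / …_split_baseChange_anyPrime, modularity) and
the referee-passed MEMO inputs (Kato ⊗ℚ at a multiplicative 2: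
X5.O1.KatoMultiplicativeDivisibilityRat W 2, HOME mult/PROOF-MULT.md RC-2; Greenberg–Stevens at 2:
greenberg_stevens W 2, mult/PROOF-GS2.md RC-4) enter the LINES under the halves (bridge
multiplicativeRankZeroAtTwo_of_muRoad, p409679), not this glue. -/
@[route_item "route-BirchSwinnertonDyer-RealTwistEisenstein"]
def RankEqAnalyticRankLeOne : Prop :=
  Literature.NumberTheory.EllipticCurves.rank_eq_analyticRank_of_analyticRank_le_one

-- parent: PublishedInputs · child (gen 1)
/--     item stmt-BirchSwinnertonDyer-19487 · support · rank 910 · open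
    parent: PublishedInputs · by operator
    sources: GreenbergVatsal2000
[support] Greenberg–Vatsal 2000, multiplicative reduction: (λ, μ) of the algebraic and analytic
sides agree at a reducible multiplicative GV pair (`lambdaMu_multiplicative_of_gvPar`) — conjunct 14
— conjunct of PublishedInputs (stmt-BirchSwinnertonDyer-19037), BY NAME; same content, filed as a
split child so the head constant is item-stated (gate5 #15c one rule; readiness rule 2026-08-15:
cite_only dep declared by the route; director-bsd 05:15:22Z K5 staffable remedy); no crux statement
/ closes / tribunal change -/
@[route_item "route-BirchSwinnertonDyer-RealTwistEisenstein"]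
def GVLambdaMuMultiplicative : Prop :=
  Literature.NumberTheory.EllipticCurves.GreenbergVatsal2000.lambdaMu_multiplicative_of_gvPar

-- parent: PublishedInputs · child (gen 1)
/--     item stmt-BirchSwinnertonDyer-19488 · support · rank 911 · open
    parent: PublishedInputs · by operator
    sources: Wuthrich2014
[support] Wuthrich 2014 (Trans. AMS 366) Thm. 16: Kato-side divisibility char X(E/ℚ_∞) ∣ (L_p(E)) at
multiplicative p with E[p] reducible (`thm16_charIdeal_dvd_multiplicative_of_reducible`) — conjunct
15 — conjunct of PublishedInputs (stmt-BirchSwinnertonDyer-19037), BY NAME; same content, filed as a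
split child so the head constant is item-stated (gate5 #15c one rule; readiness rule 2026-08-15:
cite_only dep declared by the route; director-bsd 05:15:22Z K5 staffable remedy); no crux statement
/ closes / tribunal change -/
@[route_item "route-BirchSwinnertonDyer-RealTwistEisenstein"]
def WuthrichMultiplicativeDivisibilityReducible : Prop :=
  Literature.NumberTheory.EllipticCurves.Wuthrich2014.thm16_charIdeal_dvd_multiplicative_of_reducible

-- parent: PublishedInputs · child (gen 1)
/--     item stmt-BirchSwinnertonDyer-19489 · support · rank 912 · open
    parent: PublishedInputs · by operator
    sources: GrossZagier1986, Kolyvagin1990, Schneider1985, PerrinRiou1987, SteinWuthrich2013, GreenbergStevens1993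
[support] conjuncts 9, 10, 12, 13, 16, 17, 18, 19, 20 of PublishedInputs VERBATIM as one tail
conjunction (Gross–Zagier and Kolyvagin over K (∀-closures), Schneider 1985 (odd p), Perrin-Riou
rank-one leading terms (odd p), Stein–Wuthrich 2013 Thm. 6.1 split / non-split + canonical
multiplicative heights (existence), Greenberg–Stevens 1993 (∀-closure)) — the k = 12 split shape
(items cap 15 forbids 17 asides; split.k_max forbids 18 children): the six cite_only constants
inside it are item-stated BY NAME as `aside` items of this route (SchneiderOrderCharGeneratorOdd,
PerrinRiouRankOneLeadingTermsOdd, SteinWuthrichLeadingTermSplit, SteinWuthrichLeadingTermNonsplit,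
SteinWuthrichSplitMultCanonicalExists, SteinWuthrichMultCanonicalExists); the three ∀-closures
(gross_zagier, kolyvagin, greenberg_stevens) are not cite_only deps. conjunct of PublishedInputs
(stmt-BirchSwinnertonDyer-19037), BY NAME; same content, filed as a split child so the head constant
is item-stated (gate5 #15c one rule; readiness rule 2026-08-15: cite_only dep declared by the route;
director-bsd 05:15:22Z K5 staffable remedy); no crux statement / closes / tribunal change -/
@[route_item "route-BirchSwinnertonDyer-RealTwistEisenstein"]
def PublishedInputsTail : Prop :=
  (∀ (N : ℕ) [NeZero N] (W : WeierstrassCurve ℚ) (K : Type) [Field K] [NumberField K], Literature.NumberTheory.EllipticCurves.gross_zagier N W K) ∧ (∀ (N : ℕ) [NeZero N] (W : WeierstrassCurve ℚ) (K : Type) [Field K] [NumberField K], Literature.NumberTheory.EllipticCurves.kolyvagin N W K) ∧ Literature.NumberTheory.EllipticCurves.Schneider1985_order_charGenerator_odd ∧ Literature.NumberTheory.EllipticCurves.perrinRiou_rankOne_leadingTerms_odd ∧ Literature.NumberTheory.EllipticCurves.SteinWuthrich2013.thm61_splitMultiplicative ∧ Literature.NumberTheory.EllipticCurves.SteinWuthrich2013.thm61_nonsplitMultiplicative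 ∧ Literature.NumberTheory.EllipticCurves.SteinWuthrich2013.exists_isSplitMultCanonical ∧ Literature.NumberTheory.EllipticCurves.SteinWuthrich2013.exists_isMultCanonical ∧ (∀ (W : WeierstrassCurve ℚ) [W.IsElliptic] [W.IsGloballyMinimal] (p : ℕ) [Fact p.Prime], Literature.NumberTheory.EllipticCurves.greenberg_stevens (W := W) (p := p))

-- parent: PublishedInputs · glue (gen 1)
/--     item stmt-BirchSwinnertonDyer-20268 · support · rank 913 · closed · moot by None
    parent: PublishedInputs · GLUE: children ⟹ parent · by planner
children = eleven cite_only conjuncts of PublishedInputs BY NAME (conjuncts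
1,2,3,4,5,6,7,8,11,14,15; statement = the constant) + the tail child PublishedInputsTail (conjuncts
9,10,12,13,16,17,18,19,20 verbatim); glue PublishedInputsOfParts : C1 → … → C11 →
PublishedInputsTail → PublishedInputs is reassembly of the 20 conjuncts in the parent's order —
identical by name to route EisensteinPrimes' family (items 19485…19489, glue 19490 proved by
publishedInputsOfParts_holds), dedup intended -/
@[route_item "route-BirchSwinnertonDyer-RealTwistEisenstein"]
def PublishedInputsOfParts : Prop :=
  CGLSAnticyclotomicControlTorsionFree → BSDQuotientIsogenyInvariance → GVCharIdealEqOfGVPar → GreenbergCharValueRankZero → ModularParametrizationSupply → NewformOfEllipticCurve → HoffsteinLuoNonvanishingTwist → GrossZagierRationalPointI73 → RankEqAnalyticRankLeOne → GVLambdaMuMultiplicative → WuthrichMultiplicativeDivisibilityReducible → PublishedInputsTail → PublishedInputs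

/-- item stmt-BirchSwinnertonDyer-19285 · support · rank 9 · open · by operator
sources: Wuthrich2014
[support] Wuthrich 2014 Prop. 21 (p. 400): #Ш[p^∞] divides the analytic Ш under the Kato-side
divisibility (reducible/any image) — conjunct of PublishedSignedInputs
(stmt-BirchSwinnertonDyer-19005), BY NAME; same content, filed as a split child so the head constant
is item-stated (gate5 #15c one rule; readiness rule 2026-08-15: cite_only dep declared by the
route); no statement / closes / tribunal change -/
@[route_item "route-BirchSwinnertonDyer-RealTwistEisenstein", crux]
def WuthrichShaDvdAnalyticSha : Prop :=
  Literature.NumberTheory.EllipticCurves.Wuthrich2014.sha_dvd_analyticSha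

/-- item stmt-BirchSwinnertonDyer-19470 · aside · rank 9 · open · by planner
sources: Schneider1985
[aside] Schneider 1985 (Invent. Math. 79) Thm. 2′: for odd p (good ordinary or multiplicative),
ord_T of the characteristic power series vs rank and the leading-term formula with the p-adic height
(`Schneider1985_order_charGenerator_odd`) — conjunct 12. Banked context (D-0019 aside): never
staffed, not progress, BC6-exempt; filed ONLY so the cite_only head constant inside the tail child
PublishedInputsTail of the PublishedInputs split is item-stated BY NAME (gate5 #15c one rule, kind
support OR aside counts; K3 README fallback shape; director-bsd 05:15:22Z K5 staffable remedy); no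
crux statement / closes / tribunal / tribunal_fit change intended. -/
@[route_item "route-BirchSwinnertonDyer-RealTwistEisenstein"]
def SchneiderOrderCharGeneratorOdd : Prop :=
  Literature.NumberTheory.EllipticCurves.Schneider1985_order_charGenerator_odd

/-- item stmt-BirchSwinnertonDyer-19471 · aside · rank 9 · open · by planner
sources: PerrinRiou1987
[aside] Perrin-Riou 1987 (p-adic Gross–Zagier, odd p): rank-one leading terms of the p-adic
L-function / characteristic series vs the p-adic height of the Heegner point
(`perrinRiou_rankOne_leadingTerms_odd`) — conjunct 13. Banked context (D-0019 aside): never staffed,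
not progress, BC6-exempt; filed ONLY so the cite_only head constant inside the tail child
PublishedInputsTail of the PublishedInputs split is item-stated BY NAME (gate5 #15c one rule, kind
support OR aside counts; K3 README fallback shape; director-bsd 05:15:22Z K5 staffable remedy); no
crux statement / closes / tribunal / tribunal_fit change intended. -/
@[route_item "route-BirchSwinnertonDyer-RealTwistEisenstein"]
def PerrinRiouRankOneLeadingTermsOdd : Prop :=
  Literature.NumberTheory.EllipticCurves.perrinRiou_rankOne_leadingTerms_odd

/-- item stmt-BirchSwinnertonDyer-19472 · aside · rank 9 · open · by planner
sources: SteinWuthrich2013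
[aside] Stein–Wuthrich 2013 (Math. Comp. 82) Thm. 6.1, split multiplicative case: leading term of
the characteristic series with the extra zero (`thm61_splitMultiplicative`) — conjunct 16. Banked
context (D-0019 aside): never staffed, not progress, BC6-exempt; filed ONLY so the cite_only head
constant inside the tail child PublishedInputsTail of the PublishedInputs split is item-stated BY
NAME (gate5 #15c one rule, kind support OR aside counts; K3 README fallback shape; director-bsd
05:15:22Z K5 staffable remedy); no crux statement / closes / tribunal / tribunal_fit change
intended. -/
@[route_item "route-BirchSwinnertonDyer-RealTwistEisenstein"]
def SteinWuthrichLeadingTermSplit : Prop :=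
  Literature.NumberTheory.EllipticCurves.SteinWuthrich2013.thm61_splitMultiplicative

/-- item stmt-BirchSwinnertonDyer-19473 · aside · rank 9 · open · by planner
sources: SteinWuthrich2013
[aside] Stein–Wuthrich 2013 Thm. 6.1, non-split multiplicative case (`thm61_nonsplitMultiplicative`)
— conjunct 17. Banked context (D-0019 aside): never staffed, not progress, BC6-exempt; filed ONLY so
the cite_only head constant inside the tail child PublishedInputsTail of the PublishedInputs split
is item-stated BY NAME (gate5 #15c one rule, kind support OR aside counts; K3 README fallback shape;
director-bsd 05:15:22Z K5 staffable remedy); no crux statement / closes / tribunal / tribunal_fit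
change intended. -/
@[route_item "route-BirchSwinnertonDyer-RealTwistEisenstein"]
def SteinWuthrichLeadingTermNonsplit : Prop :=
  Literature.NumberTheory.EllipticCurves.SteinWuthrich2013.thm61_nonsplitMultiplicative

-- earlier Assembly (stmt-BirchSwinnertonDyer-20222, replaced 2026-08-27T05:52:50Z -> stmt-BirchSwinnertonDyer-20336): retired by None — RealTwistEisensteinCriterion → RealTwistCriterionSupply → UnbalancedRankZeroResidual → GoodLatticeBDPValue → PublishedInputs → WuthrichShaDvdAnalyticSha → Summit.BirchSwinnertonDyer.WAllCornerX1
/-- item stmt-BirchSwinnertonDyer-20336 · assembly · rank 1 · closed · moot by None · by planner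
sources: KellerYin2024, LecouturierWang2023
[assembly] RealTwistEisensteinCriterion → RealTwistCriterionSupply → UnbalancedRankZeroBSDp →
GoodLatticeBDPValue → PublishedInputs → WuthrichShaDvdAnalyticSha → WAllCornerX1 (the deciding
theorem `closes` proves exactly this implication and applies it). -/
@[route_item "route-BirchSwinnertonDyer-RealTwistEisenstein"]
def Assembly : Prop :=
  RealTwistEisensteinCriterion → RealTwistCriterionSupply → UnbalancedRankZeroBSDp → GoodLatticeBDPValue → PublishedInputs → WuthrichShaDvdAnalyticSha → Summit.BirchSwinnertonDyer.WAllCornerX1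

-- records of items no longer active in this route (dropped / restated):
-- earlier UnbalancedRankZeroResidual (stmt-BirchSwinnertonDyer-20221, replaced 2026-08-27T05:52:50Z -> stmt-BirchSwinnertonDyer-20335): retired by None — ∀ (W : WeierstrassCurve ℚ) [W.IsElliptic] [W.IsGloballyMinimal] (p : ℕ) [Fact p.Prime], Summit.BirchSwinnertonDyer.Rank1Residual.X1.RankZero.Leaf W p → ¬ (Squarefree (W.conductorNorm ℤ) ∧ ∃ (W' : WeierstrassCurve ℚ) (_ : W'.IsElliptic) (_ : W'.IsGl

/-! D-0027 §2.1 — DECIDING THEOREM (planner-authored via `route open/edit --closes-file`; by planner-bsd-wall-eis-g0-0 2026-08-27T05:52:50Z) — ARCHIVED: route closed (superseded) 2026-08-27T07:16:10Z; kept so importers keep building: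
its hypotheses are this route's items and its conclusion the registered leaf `Summit.BirchSwinnertonDyer.WAllCornerX1` (rung W-ALL/4, D-0061) (glue_lint), and it elaborates with this file. -/

@[closes "route-BirchSwinnertonDyer-RealTwistEisenstein"] theorem closes (h₁ : RealTwistEisensteinCriterion) (h₂ : RealTwistCriterionSupply)
    (h₃ : UnbalancedRankZeroBSDp) (h₄ : GoodLatticeBDPValue) (h₅ : PublishedInputs)
    (h₆ : WuthrichShaDvdAnalyticSha) : Summit.BirchSwinnertonDyer.WAllCornerX1 := by
  have hA : Assembly := by
    intro h₁ h₂ h₃ h₄ h₅ h₆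
    classical
    -- the balanced cell in certificate currency, from the two deciding cruxes
    have hBal : ∀ (V : WeierstrassCurve ℚ) [V.IsElliptic] [V.IsGloballyMinimal] (p : ℕ) [Fact p.Prime],
        Summit.BirchSwinnertonDyer.Rank1Residual.X1.RankZero.Leaf V p →
        (Squarefree (V.conductorNorm ℤ) ∧
          ∃ (W' : WeierstrassCurve ℚ) (_ : W'.IsElliptic) (_ : W'.IsGloballyMinimal),
            WeierstrassCurve.IsIsogenous V W' ∧ p ∣ W'.torsionOrder ∧ padicValNat p W'.tamagawaProduct = 1) →
        Summit.BirchSwinnertonDyer.Rank1Residual.X1.RankZeroDoubleTwist.DoubleTwistPartnerAt V p := by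
      intro V _ _ p _ hL hB
      obtain ⟨K, _, _, hIQ, hodd, hlt, hHN, hHp, Wd, _, _, hWd, hr1, K', _, _, hIQ', hodd', hlt', hHN',
        hHp', hF⟩ := h₂ V p hL hB
      obtain ⟨hL1, Wdd, _, _, hWdd, Wc, _, _, hiso, q, hq, hv⟩ :=
        h₁ V p hL hB K hIQ hodd hlt hHN hHp Wd hWd hr1 K' hIQ' hodd' hlt' hHN' hHp' hF
      exact ⟨K, inferInstance, inferInstance, hIQ, hodd, hlt, hHN, hHp, Wd, inferInstance, inferInstance, hWd,
        hr1, K', inferInstance, inferInstance, hIQ', hodd', hlt', hHN', hHp', hL1, Wdd, inferInstance,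
        inferInstance, hWdd, Wc, inferInstance, inferInstance, hiso, q, hq, hv⟩
    obtain ⟨h511, hCassels, hGV, hGr, hmodP, hmod, hHL, hGZQ, hGZ, hKo, hGZK, -⟩ := h₅
    -- the rank-0 leaf statement (row A3) from h308 + balanced certificates + the weak residual + PUB
    have h0 : Summit.BirchSwinnertonDyer.Rank1Residual.X1.RankZero.Statement :=
      Summit.BirchSwinnertonDyer.Rank1Residual.WAll.x1RankZeroStatement_of_h308_of_balancedCertificate_of_unbalancedBSDp
        h₄ hBal h₃ h511 h₆ hCassels hmodP hmod hGZQ hGZ hKo hGZK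
    -- the X1 conjunct: rank 0 by h0, rank 1 type B by the degenerate-locus road fed with h0, type A by KY Theorem A
    have hX : Summit.BirchSwinnertonDyer.BirchSwinnertonDyer.Theorems.Rank1ResidualX1Defs.BSDpOnClassX1 := by
      intro W _ _ p _ hX1 hr
      rcases Nat.le_one_iff_eq_zero_or_eq_one.mp hr with hr0 | hr1
      · exact h0 W p ⟨hX1, hr0⟩
      · by_cases hgv : Literature.NumberTheory.EllipticCurves.Rank1Residual.GVPar W p
        · exact Summit.BirchSwinnertonDyer.BirchSwinnertonDyer.Theorems.DegenerateLocusA2AnticyclotomicRoad.bsdp_of_classX1_of_gvPar_of_analyticRank_eq_one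
            h₄ h511 (fun W' _ _ hX1' hr0' ↦ h0 W' p ⟨hX1', hr0'⟩) hCassels hmodP hmod hHL hGZQ hGZ hKo
            hGZK W hX1 hgv hr1
        · exact Summit.BirchSwinnertonDyer.Rank1Residual.X1.KellerYinTheoremA.forall_bsdp_classX1_typeA_rankOne
            h₄ h511 hCassels hGV hGr hmodP hmod hHL hGZQ hGZ hKo hGZK W p hX1 hgv hr1
    exact Summit.BirchSwinnertonDyer.Rank1Residual.WAll.wallCornerX1_of_bsdpOnClassX1 hX
  exact hA h₁ h₂ h₃ h₄ h₅ h₆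

end Summit.BirchSwinnertonDyer.BirchSwinnertonDyer.Theses.RealTwistEisenstein
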